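import Summits.AtomisticToContinuum.Crystallization.Theorems.FrustratedLawDichotomyCellClasses

/-!
# FrustratedLawDichotomy · crux `AperiodicFrustratedLawGap` (stmt-AtomisticToContinuum-27623) — CELL-SOUND XIII: INTEGER-TRIPLE LABELS
(cell decomp-a2c, lens-5 g113; KFILE-FORMAT ed2 §1 «kernel-enumerated labels», hand-2 kernel MUSTs)

The K-files enumerate ≈ 10⁴ labels in the kernel.  This file lets the label type be the PLAIN TRIPLE `ι := ℤ × ℤ × ℤ` (structural
`DecidableEq`, cheap assoc-list lookups) while every frame lemma keeps its `z : ι → Fin 3 → ℤ` shape: `zT t := ![t.1, t.2.1, t.2.2]` is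
injective (`zT_injective`, so (261) `sep_of_intTemplate`'s `hinj` is free), and the frame's integer quantities are rewritten into triple
arithmetic that `decide` evaluates directly: `sumSq_zT` (`Σ zᵢ² = sqT`), `sumSq_zT_sub` (list radii, (261) `ballL`: `mem_ballL_zT`), `dot_zT`
(plane predicates of class-H cells, (267)), `absSum_zT` (the `g_hi` of (267) `gram_le_dot_add`), and the parity-lattice facts `even_sqT_sub`,
★ `two_le_sqT_sub` (distinct sites of the fcc parity frame have `|Δz|² ≥ 2` — structural, never pairwise).

House conventions: SI units · italic scalars, bold vectors, sans-serif tensors · numbered formulae only when referenced · en-dash for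
ranges · References = cited works, numbered, alphabetical · no footnotes; Remarks at section ends · British spelling, -ise · Lennard-Jones
hyphenated; NASH capitalised as the Statement's notion · "folklore" tags standard bookkeeping; no new references are cited in this file.
-/

namespace Summit.AtomisticToContinuum.Crystallization.Theorems.FrustratedLawDichotomyCellTriples

open scoped BigOperators
open Summit.AtomisticToContinuum.Crystallization.Theorems.FrustratedLawDichotomyCellClasses (ballL)

/-- the label vector of an integer triple. -/
def zT (t : ℤ × ℤ × ℤ) : Fin 3 → ℤ := ![t.1, t.2.1, t.2.2]

/-- `|t|²` in triple arithmetic. -/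
def sqT (t : ℤ × ℤ × ℤ) : ℤ := t.1 ^ 2 + t.2.1 ^ 2 + t.2.2 ^ 2

/-- componentwise difference. -/
def subT (t t' : ℤ × ℤ × ℤ) : ℤ × ℤ × ℤ := (t.1 - t'.1, t.2.1 - t'.2.1, t.2.2 - t'.2.2)

/-- `t·n` in triple arithmetic. -/
def dotT (t n : ℤ × ℤ × ℤ) : ℤ := t.1 * n.1 + t.2.1 * n.2.1 + t.2.2 * n.2.2

/-- `Σ|tᵢ|` in triple arithmetic. -/
def absT (t : ℤ × ℤ × ℤ) : ℤ := |t.1| + |t.2.1| + |t.2.2|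

/-- coordinate sum (parity of the fcc frame). -/
def sumT (t : ℤ × ℤ × ℤ) : ℤ := t.1 + t.2.1 + t.2.2

/-- [folklore] -/
@[simp] theorem zT_zero (t : ℤ × ℤ × ℤ) : zT t 0 = t.1 := rfl
/-- [folklore] -/
@[simp] theorem zT_one (t : ℤ × ℤ × ℤ) : zT t 1 = t.2.1 := rfl
/-- [folklore] -/
@[simp] theorem zT_two (t : ℤ × ℤ × ℤ) : zT t 2 = t.2.2 := rfl

/-- ★ triples ARE their label vectors: (261) `sep_of_intTemplate`'s injectivity hypothesis for free. [folklore] -/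
theorem zT_injective : Function.Injective zT := by
  intro t t' h
  have h0 := congrFun h 0; have h1 := congrFun h 1; have h2 := congrFun h 2
  simp only [zT_zero, zT_one, zT_two] at h0 h1 h2
  exact Prod.ext h0 (Prod.ext h1 h2)

/-- the `hinj` shape of (261). [folklore] -/
theorem zT_inj_on (M : Finset (ℤ × ℤ × ℤ)) : ∀ m ∈ M, ∀ m' ∈ M, m ≠ m' → zT m ≠ zT m' :=
  fun _ _ _ _ hne h => hne (zT_injective h)

/-- [folklore] -/
theorem sumSq_zT (t : ℤ × ℤ × ℤ) : ∑ i, zT t i ^ 2 = sqT t := by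
  simp [Fin.sum_univ_three, sqT]

/-- [folklore] -/
theorem zT_sub (t t' : ℤ × ℤ × ℤ) (i : Fin 3) : zT t i - zT t' i = zT (subT t t') i := by
  fin_cases i <;> rfl

/-- the list radii of (261) `ballL` in triple arithmetic. [folklore] -/
theorem sumSq_zT_sub (t t' : ℤ × ℤ × ℤ) : ∑ i, (zT t i - zT t' i) ^ 2 = sqT (subT t t') := by
  simp [Fin.sum_univ_three, sqT, subT]

/-- [folklore] -/
theorem dot_zT (t n : ℤ × ℤ × ℤ) : ∑ i, zT t i * zT n i = dotT t n := by
  simp [Fin.sum_univ_three, dotT]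

/-- [folklore] -/
theorem absSum_zT (t : ℤ × ℤ × ℤ) : ∑ i, |zT t i| = absT t := by
  simp [Fin.sum_univ_three, absT]

/-- [folklore] -/
theorem sum_zT (t : ℤ × ℤ × ℤ) : ∑ i, zT t i = sumT t := by
  simp [Fin.sum_univ_three, sumT]

/-- membership in a (261) list in triple arithmetic (so the lists are computed on triples). [folklore] -/
theorem mem_ballL_zT {M : Finset (ℤ × ℤ × ℤ)} {ℓ : ℤ} {c x : ℤ × ℤ × ℤ} : x ∈ ballL M zT ℓ c ↔ x ∈ M ∧ sqT (subT x c) < ℓ := by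
  unfold ballL
  rw [Finset.mem_filter, sumSq_zT_sub]

/-- the (261) lists as filters on triple arithmetic (rewrite BEFORE `decide`; the kernel then never sees `Fin 3` sums). [folklore] -/
theorem ballL_zT_eq (M : Finset (ℤ × ℤ × ℤ)) (ℓ : ℤ) (c : ℤ × ℤ × ℤ) : ballL M zT ℓ c = M.filter fun x => sqT (subT x c) < ℓ := by
  ext x
  rw [mem_ballL_zT, Finset.mem_filter]

/-- real casts of the template coordinates: `a t = h • zT t` has `Σ aᵢ² = h²·sqT t`. [folklore] -/
theorem sumSq_cast_zT (h : ℝ) (t : ℤ × ℤ × ℤ) : ∑ i, (h * (zT t i : ℝ)) ^ 2 = h ^ 2 * (sqT t : ℝ) := by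
  rw [← sumSq_zT]; push_cast; simp [Fin.sum_univ_three]; ring

/-! ## The parity frame (fcc = {Σ zᵢ even}) -/

/-- [folklore] -/
theorem sumT_subT (t t' : ℤ × ℤ × ℤ) : sumT (subT t t') = sumT t - sumT t' := by
  simp only [sumT, subT]; ring

/-- `|d|² ≡ Σ dᵢ (mod 2)`. [folklore] -/
theorem even_sqT_sub_sumT (d : ℤ × ℤ × ℤ) : Even (sqT d - sumT d) := by
  have h1 := Int.even_mul_pred_self d.1
  have h2 := Int.even_mul_pred_self d.2.1
  have h3 := Int.even_mul_pred_self d.2.2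
  have : sqT d - sumT d = d.1 * (d.1 - 1) + d.2.1 * (d.2.1 - 1) + d.2.2 * (d.2.2 - 1) := by simp only [sqT, sumT]; ring
  rw [this]
  exact (h1.add h2).add h3

/-- differences of parity-frame sites have even `|Δz|²`. [folklore] -/
theorem even_sqT_sub {t t' : ℤ × ℤ × ℤ} (ht : Even (sumT t)) (ht' : Even (sumT t')) : Even (sqT (subT t t')) := by
  have h := even_sqT_sub_sumT (subT t t')
  rw [sumT_subT] at h
  have h2 : Even (sumT t - sumT t') := ht.sub ht'
  simpa using h.add h2

/-- [folklore] -/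
theorem one_le_sqT_of_ne {t t' : ℤ × ℤ × ℤ} (hne : t ≠ t') : 1 ≤ sqT (subT t t') := by
  simp only [sqT, subT]
  by_contra hlt
  rw [not_le] at hlt
  have h1 : (t.1 - t'.1) ^ 2 = 0 := by nlinarith [sq_nonneg (t.1 - t'.1), sq_nonneg (t.2.1 - t'.2.1), sq_nonneg (t.2.2 - t'.2.2)]
  have h2 : (t.2.1 - t'.2.1) ^ 2 = 0 := by nlinarith [sq_nonneg (t.1 - t'.1), sq_nonneg (t.2.1 - t'.2.1), sq_nonneg (t.2.2 - t'.2.2)]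
  have h3 : (t.2.2 - t'.2.2) ^ 2 = 0 := by nlinarith [sq_nonneg (t.1 - t'.1), sq_nonneg (t.2.1 - t'.2.1), sq_nonneg (t.2.2 - t'.2.2)]
  have e1 := sub_eq_zero.mp (pow_eq_zero_iff (n := 2) (by norm_num) |>.mp h1)
  have e2 := sub_eq_zero.mp (pow_eq_zero_iff (n := 2) (by norm_num) |>.mp h2)
  have e3 := sub_eq_zero.mp (pow_eq_zero_iff (n := 2) (by norm_num) |>.mp h3)
  exact hne (Prod.ext e1 (Prod.ext e2 e3))

/-- ★ distinct parity-frame sites are `|Δz|² ≥ 2` apart — the fcc nearest-neighbour bound, STRUCTURAL (no pairwise `decide`). [folklore] -/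
theorem two_le_sqT_sub {t t' : ℤ × ℤ × ℤ} (ht : Even (sumT t)) (ht' : Even (sumT t')) (hne : t ≠ t') : 2 ≤ sqT (subT t t') := by
  obtain ⟨k, hk⟩ := even_sqT_sub ht ht'
  have h1 := one_le_sqT_of_ne hne
  omega

/-- the same in the frame's `Σ (zᵢ − zᵢ')²` shape ((261) `le_dist_of_intRadius` with `ℓ = 2`). [folklore] -/
theorem two_le_sumSq_zT_sub {t t' : ℤ × ℤ × ℤ} (ht : Even (sumT t)) (ht' : Even (sumT t')) (hne : t ≠ t') :
    2 ≤ ∑ i, (zT t i - zT t' i) ^ 2 := by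
  rw [sumSq_zT_sub]; exact two_le_sqT_sub ht ht' hne

end Summit.AtomisticToContinuum.Crystallization.Theorems.FrustratedLawDichotomyCellTriples
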